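import Summits.BirchSwinnertonDyer.BirchSwinnertonDyer.Theorems.ClassRecordThreeCornerAtThreeUpperNamedFacts
import Summits.BirchSwinnertonDyer.Rank1Residual.X10.LeafDischargeX10bKolyvaginOdd
import HarnessLib

/-!
# Route `ClassRecordThree` (rung K2@3), crux `CornerAtThree` (item stmt-BirchSwinnertonDyer-19111; re-keyed twin 21420 `CornerAtThreeW`),
# stub `stub_upper3_jetchevMaxMono` of the line of record `Cruxes/CornerAtThree/Lines/inert.lean`: THE HONEST ROAD AT ℓ = 2 —
# on frames with `d_K ≡ 1 (mod 8)` the Jetchev MAX form at `3` stands on PRINT ALONE {Gross 1991 Prop. 3.7 (2) (A′), Poitou–Tate,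
# [GZ86 III (3.1)] image-free} (cell `bsd-stepL`, seat `bsd-stepL-corner-p1` g12; `--supports stmt-BirchSwinnertonDyer-19111`)

WHY THIS FILE. This seat's g11 display `Koly.cornerUpper3_jetchevMax_of_namedFacts` (p566368) proves the body of the stub from
{the (γ)-PAIR DEF `Prop44.prop37_2_reductionCongruence_pair W K` at every frame, Poitou–Tate, [GZ86 III (3.1)] image-free}. ARM P
(r05 Q65 ADD-6, R-44 `Gr91-Prop372-pair-twin-at-ℓ2`, desk-confirmed C2 R936) graded that def STRONGER THAN PRINT exactly on
{`p = 3`, `ℓ = 2`, `ρ̄₃` not onto}: the print fact (A′) `GrossLMS1991.prop37_2_frobeniusCongruence` carries Nekovář's clause `ℓ ≠ 2 ∨ ρ̄ onto`,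
and at `p = 3` the Kolyvagin prime `ℓ = 2` (`3 ∣ ℓ + 1`, `3 ∣ a₂ = 0`, `2` inert in `K`, `2 ∤ N`) is live on 37 ∕ 296 corner pairs. ARM P's
honest road (b) (relay 39 ∕ 40): «restrict the Heegner field to `d_K ≡ 1 (mod 8)` and re-key on X10b's `…_of_discr_mod_eight_eq_one`».
This file executes it in the kernel, WITHOUT touching any definition:

* §1 `Prop44.prop37_2_reductionCongruence_pair_of_frobeniusCongruence_of_discr_mod_eight_eq_one` — on a frame with `d_K ≡ 1 (mod 8)`
  the (γ)-pair def FOLLOWS from the print fact (A′): `2` splits in `K` (Marcus Thm. 25, print-x9's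
  `not_isPrime_span_two_of_discr_mod_eight_eq_one`), so the def's inert prime `ℓ` is odd and Nekovář's clause holds by `Or.inl`.
* §2 `hlevThreeAt_of_pairAt_of_selmerSupply`, §3 `pDivThree_of_pairAt_of_namedFacts` — the g11 chain (walk input `hlev`; then
  `pDiv_of_swap_of_perLevel` with Kolyvagin's prime swap `Swap.levelRaising_of_pair_of_irreducible`) RE-THREADED PER FRAME: the pair
  congruence is consumed at the frame `(W, K)` at which the divisibility is read, and nowhere else.
* §4 `pDivThree_of_threeNamedFacts_of_discr_mod_eight` ∕ `cornerUpper3_jetchevMaxMono_of_threeNamedFacts_of_discr_mod_eight` — the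
  stub body on `d_K ≡ 1 (mod 8)` frames from {(A′), PT, GZ III (3.1)} ONLY (binder order of `Lines/inert.lean`, one extra binder).

WHY `d_K ≡ 1 (mod 8)` COSTS NOTHING DOWNSTREAM: the consumer of conjunct 3 (`Three.missingUpperBoundAt_of_cornerUpperAt`) books ONE Heegner
frame per curve, from `X11b.exists_oddHeegnerData`, i.e. from the typed Hoffstein–Luo theorem `HoffsteinLuo1997_exists_twist_L_one_ne_zero`, whose
discriminant satisfies `d % 8 = 1` BY STATEMENT; the companion file `…UpperModEightConsumed.lean` carries this to the consumed shape.

HONEST FRAMING: theorems only (no definition ∕ named fact ∕ `sorry`); every display is CONDITIONAL on NAMED, published, typed, unformalised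
Literature facts (Gross 3.7 (2) ∕ Nekovář 4.13 (ii); Poitou–Tate for the tree's Selmer structures; GZ86 III (3.1)); the registered stub (all odd
`d_K`) is NOT discharged, 19111 ∕ 21420 stay OPEN; nothing about any curve's BSD; T7. Credit: print-x9 (X10b's `d_K ≡ 1 (mod 8)` interface),
ARM P r05, lit g24 ∕ g26 ((A′) typed), and everything credited in p566368. References (locators only): [cite: GrossLMS1991, Prop. 3.7 (2) (p. 240)]
[cite: Nekovar2007, Prop. 4.13 (ii)] [cite: Marcus2018, Ch. 3 Thm. 25] [cite: HoffsteinLuo1997, Theorem (§1)] [cite: Jetchev2008, Thm. 1.4, §5–§6]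
[cite: McCallumLMS1991, §3 Cor. 3.2, §4 Prop. 4.4, §5 Prop. 5.2] [cite: GrossZagier1986, III (3.1)] [cite: MilneADT2006, Ch. I, Thm. 4.10(b)].
-/

set_option autoImplicit false
set_option linter.dupNamespace false -- `Summit.BirchSwinnertonDyer.BirchSwinnertonDyer` (summit = problem), tree-wide
noncomputable section
open scoped Classical NumberField Pointwise
open Function NumberField IsDedekindDomain WeierstrassCurve Field
open Literature.NumberTheory.EllipticCurves Literature.NumberTheory.GaloisRepresentations Literature.NumberTheory.Automorphic
open Literature.NumberTheory.EllipticCurves.Jetchev2008 Literature.NumberTheory.EllipticCurves.KolyvaginCocycle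
open Literature.NumberTheory.EllipticCurves.ModularForms Literature.NumberTheory.EllipticCurves.Rank1Residual Literature.NumberTheory.GaloisCohomology
open Literature.NumberTheory.GaloisRepresentations.DiscreteGaloisModule (transverseSubgroup SelmerStructure)
open Summit.BirchSwinnertonDyer.Rank1Residual.JET.SelmerVocabulary Summit.BirchSwinnertonDyer.Rank1Residual.JET.GlobalDuality
open Summit.BirchSwinnertonDyer.Rank1Residual Summit.BirchSwinnertonDyer.Rank1Residual.X11b Summit.BirchSwinnertonDyer.Rank1Residual.X11b.Three
open Summit.BirchSwinnertonDyer.Rank1Residual.JET Summit.BirchSwinnertonDyer.BirchSwinnertonDyer.Theorems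
open Summit.BirchSwinnertonDyer.BirchSwinnertonDyer.Theorems.HeegnerE0ImageFree Summit.BirchSwinnertonDyer.Rank1Residual.X11b.Three.Koly

/-! ### §1 On a `d_K ≡ 1 (mod 8)` frame the (γ)-pair def follows from the print fact (A′) -/

namespace Summit.BirchSwinnertonDyer.BirchSwinnertonDyer.Theorems.Prop44

/-- **On a frame with `d_K ≡ 1 (mod 8)`, Gross 1991 Prop. 3.7 (2) in PAIR form (`prop37_2_reductionCongruence_pair W K`, this seat's
g10 def) FOLLOWS from the print fact (A′) `GrossLMS1991.prop37_2_frobeniusCongruence`**: the def quantifies over primes `ℓ` with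
`(ℓ) ⊂ 𝓞_K` prime (inert); when `d_K ≡ 1 (mod 8)` the prime `2` SPLITS in `K` (`not_isPrime_span_two_of_discr_mod_eight_eq_one`), so
`ℓ ≠ 2` and Nekovář's clause of the Literature corollary `prop37_2_frobeniusCongruence.reductionCongruence_pair` holds by `Or.inl`.
So on such frames the twin is NOT stronger than print. CONDITIONAL on (A′). [cite: GrossLMS1991, Prop. 3.7 (2) (p. 240)]
[cite: Nekovar2007, Prop. 4.13 (ii), (4.3)] [cite: Marcus2018, Ch. 3 Thm. 25] -/
theorem prop37_2_reductionCongruence_pair_of_frobeniusCongruence_of_discr_mod_eight_eq_one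
    (h : GrossLMS1991.prop37_2_frobeniusCongruence)
    (W : WeierstrassCurve ℚ) [W.IsElliptic] [W.IsGloballyMinimal] [NeZero (W.conductorNorm ℤ)]
    (K : Type) [Field K] [NumberField K] (hd8 : NumberField.discr K % 8 = 1) :
    prop37_2_reductionCongruence_pair W K := by
  intro _ hK hD hH Dt β ι m ℓ hsq _hℓ _hℓm hN _hℓd hinert d' d _ hΔ φ₀ hφ₀ hle γ _
  -- the print edge `ℓ ≠ 2`: `(2)` is not prime in `𝓞_K` when `d_K ≡ 1 (mod 8)`
  have hℓ2 : ℓ ≠ 2 := by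
    rintro rfl
    exact not_isPrime_span_two_of_discr_mod_eight_eq_one hK.1 hd8 (by exact_mod_cast hinert)
  have hcop : Nat.Coprime (m * ℓ) (W.conductorNorm ℤ) :=
    (KolyvaginH37Bridge.coprime_of_forall_not_dvd hsq.ne_zero hN).symm
  exact h.reductionCongruence_pair (N := W.conductorNorm ℤ) rfl hK hD hH m ℓ hsq hcop (Or.inl hℓ2) hinert d' d hΔ hφ₀
    hle γ

end Summit.BirchSwinnertonDyer.BirchSwinnertonDyer.Theorems.Prop44

/-! ### §2 The walk input `hlev` per frame -/

namespace Summit.BirchSwinnertonDyer.Rank1Residual.X11b.Three.Koly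

open Literature.NumberTheory.GaloisRepresentations.DiscreteGaloisModule

/-- **The @3 corner's walk input `hlev` AT ONE FRAME, from the (γ)-pair congruence AT THAT FRAME and the class-wide Selmer
supply at `3`** — this seat's `hlevThree_of_pair_of_selmerSupply` (g11, p563499) with its GLOBAL binder
`h372p : ∀ W K, Prop44.prop37_2_reductionCongruence_pair W K` replaced by the single instance `h372WK` at the frame `(W, K)`
(the proof uses the pair congruence at `(W, K)` only: Gross's one system of choices with McCallum Prop. 4.7 along it,
`Prop44.exists_data_h47Base_of_prop37_2_of_irr`). Proof verbatim otherwise (admissibility (irr), Čebotarev `…_of_irr_of_neg`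
with `−1 ∈ ρ̄_{E,3}(Γ_ℚ)` automatic, image-agnostic based walk). CONDITIONAL on `h372WK` and the supply shape; nothing booked.
[cite: Jetchev2008, Thm. 1.4 (p. 812), §5–§6] [cite: McCallumLMS1991, §3 Cor. 3.2, §4 Prop. 4.4] [cite: GrossLMS1991, Prop. 3.7 (2), Prop. 5.3] -/
theorem hlevThreeAt_of_pairAt_of_selmerSupply
    (hsupply : ∀ (W : WeierstrassCurve ℚ) [W.IsElliptic] [W.IsGloballyMinimal] [NeZero (W.conductorNorm ℤ)]
      (K : Type) [Field K] [NumberField K]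
      (Dt : ModularParametrizationData W (W.conductorNorm ℤ)) (β : ℤ) (ι : K →+* ℂ),
      ClassX11b W 3 → ¬ Surj W 3 →
      IsImaginaryQuadratic K → SatisfiesHeegnerHypothesis (W.conductorNorm ℤ) K →
      Odd (NumberField.discr K) →
      (4 * (W.conductorNorm ℤ : ℤ)) ∣ β ^ 2 - NumberField.discr K → ¬ (3 : ℤ) ∣ Dt.c →
      ∀ (τ : K ≃ₐ[ℚ] K), τ ≠ 1 → ∀ (v : HeightOneSpectrum (𝓞 ℚ)) (k : ℕ), 1 ≤ k →
        padicValNat 3 (W.tamagawaNumberAt v) ≤ k →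
      ∀ (n : ℕ) (d : KolyvaginHeegnerData Dt β ι n) (hn : Squarefree n ∧ ∀ q ∈ n.primeFactors,
        Zhang2014.IsKolyvaginPrime (W.conductorNorm ℤ) W K 3 q ∧ k ≤ Zhang2014.kolyvaginIndex W 3 q),
      ∀ (D : ∀ s : {m : ℕ // Squarefree m ∧ ∀ q ∈ m.primeFactors,
        Zhang2014.IsKolyvaginPrime (W.conductorNorm ℤ) W K 3 q ∧ k ≤ Zhang2014.kolyvaginIndex W 3 q},
          KolyvaginHeegnerData Dt β ι s.1), D ⟨n, hn⟩ = d →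
      ∀ (ε : ℤ), (ε = 1 ∨ ε = -1) → ∀ (eb : ℕ → Bool),
        (∀ (m ℓ : ℕ), ℓ.Prime → ¬ ℓ ∣ m → eb (m * ℓ) = !eb m) →
        (∀ m, (if eb m then (1 : ℤ) else -1) = ε * (-1) ^ m.primeFactors.card) →
      ∃ (𝒯 𝒮 : SelmerStructure ((W.baseChange K).torsionGaloisModule ((3 ^ k : ℕ) : ℤ)))
        (Qcar : Finset (HeightOneSpectrum (𝓞 K)))
        (C' : ℕ → AddSubgroup (galoisCohomology ((W.baseChange K).torsionGaloisModule ((3 ^ k : ℕ) : ℤ)) 1)),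
        (∀ v, 𝒮 v ≤ (W.baseChange K).kummerSelmerStructure ((3 ^ k : ℕ) : ℤ) v) ∧
        (∀ v ∈ Qcar, ((W.conductorNorm ℤ : ℕ) : 𝓞 K) ∈ v.asIdeal) ∧
        (∀ (ℓ : ℕ), Zhang2014.IsKolyvaginPrime (W.conductorNorm ℤ) W K 3 ℓ →
      k ≤ Zhang2014.kolyvaginIndex W 3 ℓ → ¬ ℓ ∣ n → ∀ v : HeightOneSpectrum (𝓞 K), (ℓ : 𝓞 K) ∈ v.asIdeal →
      Disjoint ((W.baseChange K).kummerSelmerStructure ((3 ^ k : ℕ) : ℤ) (Sum.inr v)) (𝒯 (Sum.inr v))) ∧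
        (∀ (s : {m : ℕ // Squarefree m ∧ ∀ q ∈ m.primeFactors,
        Zhang2014.IsKolyvaginPrime (W.conductorNorm ℤ) W K 3 q ∧ k ≤ Zhang2014.kolyvaginIndex W 3 q})
      (ℓ : ℕ), Zhang2014.IsKolyvaginPrime (W.conductorNorm ℤ) W K 3 ℓ →
      k ≤ Zhang2014.kolyvaginIndex W 3 ℓ → ¬ ℓ ∣ s.1 → (∀ q ∈ s.1.primeFactors, q < ℓ) → n ∣ s.1 →
      ∀ v : HeightOneSpectrum (𝓞 K), (ℓ : 𝓞 K) ∈ v.asIdeal → ∀ b : Bool,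
      Nat.card ((signPart W K τ ((3 ^ k : ℕ) : ℤ) (if b then 1 else -1)
          ((selmerF W ((3 ^ k : ℕ) : ℤ) 𝒯 (placesDividing K s.1)).relaxedAt {v}).selmerGroup).map
        (galoisCohomology.localization ((W.baseChange K).torsionGaloisModule ((3 ^ k : ℕ) : ℤ))
          (Sum.inr v) 1)) = 3 ^ k) ∧
        (∀ s (u : ℕ) (Q : (W.baseChange (ringClassField K ι s.1)).toAffine.Point)
      (hAk : IsAdmissible (absoluteGaloisGroup K) (D s).pointsSubgroup ((3 ^ k : ℕ) : ℤ))
      (hQ : (D s).toGeomPoints Q ∈ invPoints (absoluteGaloisGroup K) (D s).pointsSubgroup ((3 ^ k : ℕ) : ℤ)),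
      ((3 ^ u : ℕ) : ℤ) • Q = (D s).derivedPoint →
      (¬ ∃ Q' : (W.baseChange (ringClassField K ι s.1)).toAffine.Point,
        ((3 ^ (u + 1) : ℕ) : ℤ) • Q' = (D s).derivedPoint) →
      ((u + k : ℕ) : ℕ∞) ≤ Zhang2014.levelIndex W 3 s.1 →
      (kolyvaginClass (W.baseChange K) ((3 ^ k : ℕ) : ℤ)
        ((W.baseChange K).zsmul_geomPoints_surjective_of_charZero
          (by exact_mod_cast pow_ne_zero k Nat.prime_three.ne_zero)) hAk ((D s).toGeomPoints Q) hQ :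
          galoisCohomology ((W.baseChange K).torsionGaloisModule ((3 ^ k : ℕ) : ℤ)) 1) ∈
        (selmerF W ((3 ^ k : ℕ) : ℤ) 𝒯 (placesDividing K s.1)).selmerGroup) ∧
        (∀ m, C' m ≤ signPart W K τ ((3 ^ k : ℕ) : ℤ) (if !eb m then 1 else -1) ⊤) ∧
        (∀ s : {m : ℕ // Squarefree m ∧ ∀ q ∈ m.primeFactors,
        Zhang2014.IsKolyvaginPrime (W.conductorNorm ℤ) W K 3 q ∧ k ≤ Zhang2014.kolyvaginIndex W 3 q},
      n ∣ s.1 → ∃ (Qg Qg' : Type) (_ : AddCommGroup Qg) (_ : AddCommGroup Qg') (_ : Finite Qg')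
        (locq : signPart W K τ ((3 ^ k : ℕ) : ℤ) (if !eb s.1 then 1 else -1)
            (selmerF W ((3 ^ k : ℕ) : ℤ) 𝒯 (placesDividing K s.1)).selmerGroup →+ Qg)
        (locq' : C' s.1 →+ Qg'),
        (∀ x : C' s.1, locq' x = 0 ↔
          (x : galoisCohomology ((W.baseChange K).torsionGaloisModule ((3 ^ k : ℕ) : ℤ)) 1) ∈
            signPart W K τ ((3 ^ k : ℕ) : ℤ) (if !eb s.1 then 1 else -1)
              (selmerF W ((3 ^ k : ℕ) : ℤ) 𝒯 (placesDividing K s.1)).selmerGroup) ∧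
        Nat.card locq.range * Nat.card locq'.range = Nat.card Qg' ∧ IsAddCyclic Qg' ∧
        Nat.card Qg' = 3 ^ padicValNat 3 (W.tamagawaNumberAt v)) ∧
        (∀ (s s' : {m : ℕ // Squarefree m ∧ ∀ q ∈ m.primeFactors,
        Zhang2014.IsKolyvaginPrime (W.conductorNorm ℤ) W K 3 q ∧ k ≤ Zhang2014.kolyvaginIndex W 3 q})
      (ℓ : ℕ), ℓ.Prime → ¬ ℓ ∣ s.1 → s'.1 = s.1 * ℓ → (∀ q ∈ s.1.primeFactors, q < ℓ) → n ∣ s.1 →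
      ∀ v : HeightOneSpectrum (𝓞 K), (ℓ : 𝓞 K) ∈ v.asIdeal →
      ((D s').kolyvaginClass Nat.prime_three k :
          galoisCohomology ((W.baseChange K).torsionGaloisModule ((3 ^ k : ℕ) : ℤ)) 1) ∈
        (((selmerF0 W ((3 ^ k : ℕ) : ℤ) 𝒯 𝒮 (placesDividing K s.1) Qcar).relaxedAt {v}).selmerGroup)) ∧
        (∀ (s : {m : ℕ // Squarefree m ∧ ∀ q ∈ m.primeFactors,
        Zhang2014.IsKolyvaginPrime (W.conductorNorm ℤ) W K 3 q ∧ k ≤ Zhang2014.kolyvaginIndex W 3 q})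
      (ℓ : ℕ), Zhang2014.IsKolyvaginPrime (W.conductorNorm ℤ) W K 3 ℓ →
      k ≤ Zhang2014.kolyvaginIndex W 3 ℓ → ¬ ℓ ∣ s.1 → (∀ q ∈ s.1.primeFactors, q < ℓ) → n ∣ s.1 →
      ∀ v : HeightOneSpectrum (𝓞 K), (ℓ : 𝓞 K) ∈ v.asIdeal →
      ∃ (Sg : Type) (_ : AddCommGroup Sg)
        (sing : signPart W K τ ((3 ^ k : ℕ) : ℤ) (if !eb s.1 then 1 else -1)
            (((selmerF0 W ((3 ^ k : ℕ) : ℤ) 𝒯 𝒮 (placesDividing K s.1) Qcar).relaxedAt {v}).selmerGroup)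
          →+ Sg),
        (∀ x, sing x = 0 ↔
          (x : galoisCohomology ((W.baseChange K).torsionGaloisModule ((3 ^ k : ℕ) : ℤ)) 1) ∈
            signPart W K τ ((3 ^ k : ℕ) : ℤ) (if !eb s.1 then 1 else -1)
              ((selmerF0 W ((3 ^ k : ℕ) : ℤ) 𝒯 𝒮 (placesDividing K s.1) Qcar).selmerGroup)) ∧
        Nat.card sing.range *
          Nat.card ((C' s.1).map (galoisCohomology.localization
            ((W.baseChange K).torsionGaloisModule ((3 ^ k : ℕ) : ℤ)) (Sum.inr v) 1)) = 3 ^ k))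
    (W : WeierstrassCurve ℚ) [W.IsElliptic] [W.IsGloballyMinimal] [NeZero (W.conductorNorm ℤ)]
    (K : Type) [Field K] [NumberField K]
    (Dt : ModularParametrizationData W (W.conductorNorm ℤ)) (β : ℤ) (ι : K →+* ℂ)
    (hX : ClassX11b W 3) (hns : ¬ Surj W 3)
    (hK' : IsImaginaryQuadratic K) (hHN : SatisfiesHeegnerHypothesis (W.conductorNorm ℤ) K)
    (hodd : Odd (NumberField.discr K))
    (hβ : (4 * (W.conductorNorm ℤ : ℤ)) ∣ β ^ 2 - NumberField.discr K) (hc : ¬ (3 : ℤ) ∣ Dt.c)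
    -- the (γ)-pair congruence AT THIS FRAME ONLY
    (h372WK : Prop44.prop37_2_reductionCongruence_pair W K) (v : HeightOneSpectrum (𝓞 ℚ)) :
      ∀ (k n : ℕ) (d : KolyvaginHeegnerData Dt β ι n), Squarefree n →
        (∀ ℓ ∈ n.primeFactors, Zhang2014.IsKolyvaginPrime (W.conductorNorm ℤ) W K 3 ℓ) →
        (if divOrd d 3 < Zhang2014.levelIndex W 3 n then divOrd d 3 else (⊤ : ℕ∞)) < (k : ℕ∞) →
        padicValNat 3 (W.tamagawaNumberAt v) ≤ k →
        (k : ℕ∞) + (if divOrd d 3 < Zhang2014.levelIndex W 3 n then divOrd d 3 else ⊤) ≤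
          Zhang2014.levelIndex W 3 n →
        (padicValNat 3 (W.tamagawaNumberAt v) : ℕ∞) ≤
          (if divOrd d 3 < Zhang2014.levelIndex W 3 n then divOrd d 3 else ⊤) := by
  haveI : Fact (Nat.Prime 3) := ⟨Nat.prime_three⟩
  intro k n d hsq hkol h1 h2 h3
  have hp : (3 : ℕ).Prime := Nat.prime_three
  have hp2 : (3 : ℕ) ≠ 2 := by decide
  have hirr : W.HasIrreducibleModPGaloisRep 3 := hX.2.2.2
  have h3N : 3 ∣ W.conductorNorm ℤ := dvd_conductorNorm_of_mult hX.2.2.1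
  have hHp : SatisfiesHeegnerHypothesis 3 K := hHN.of_dvd h3N
  have h3d : ¬ (3 : ℤ) ∣ NumberField.discr K := by
    exact_mod_cast Literature.SatisfiesHeegnerHypothesis.not_dvd_discr hK'.1 hHN Nat.prime_three h3N
  have hd : 4 < (NumberField.discr K).natAbs := four_lt_natAbs_discr_of_odd hK'.1 hodd h3d
  -- `k ≥ 1` and the admissibility of `n` at level `k`
  have hk : 1 ≤ k := by
    rcases Nat.eq_zero_or_pos k with rfl | hk
    · exact absurd h1 (by simp)
    · exact hk
  have hkM : (k : ℕ∞) ≤ Zhang2014.levelIndex W 3 n := le_trans le_self_add h3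
  have hn : Squarefree n ∧ ∀ q ∈ n.primeFactors,
      Zhang2014.IsKolyvaginPrime (W.conductorNorm ℤ) W K 3 q ∧ k ≤ Zhang2014.kolyvaginIndex W 3 q :=
    ⟨hsq, fun q hq ↦ ⟨hkol q hq, Zhang2014.natCast_le_levelIndex_iff.mp hkM q hq⟩⟩
  -- frame facts
  obtain ⟨τ, hτ⟩ := exists_algEquiv_ne_one_of_isImaginaryQuadratic K hK'
  have hND : IsCoprime ((W.conductorNorm ℤ : ℕ) : ℤ) (NumberField.discr K) :=
    KolyvaginAssembly.isCoprime_discr_of_satisfiesHeegnerHypothesis hK' hHN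
  have hDneg : NumberField.discr K < 0 := (isImaginaryQuadratic_iff_discr_neg.1 hK').2
  have hD : NumberField.discr K < -4 := by omega
  obtain ⟨q, hq, hqd, hqN, hqp⟩ := exists_prime_dvd_discr_of_heegner hK'.1 hd hHN hHp
  have hneg : ∃ γ : Field.absoluteGaloisGroup ℚ, ∀ P : geomTorsion W 3, γ • P = -P := by
    obtain ⟨γ, hγ⟩ := ShimuraKolyvaginMinusOneSquare.exists_sq_smul_eq_neg_three_of_irr W hirr
    exact ⟨γ * γ, fun P ↦ by rw [mul_smul]; exact hγ P⟩
  -- Gross's one system of choices extending `d`, and Prop. 4.7 for it — KERNEL modulo the (γ)-pair congruence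
  obtain ⟨D, hDd, h47⟩ := Prop44.exists_data_h47Base_of_prop37_2_of_irr h372WK hK' hD hHN hp2 hHp hirr Dt β ι hk hn d
  -- the sign `ε := −w(E)`, a sign function for it, and Gross Prop. 5.3 for the data (bsd-jet's THEOREM)
  have hε : (-W.rootNumber : ℤ) = 1 ∨ (-W.rootNumber : ℤ) = -1 := by
    rcases W.rootNumber_eq_one_or with h | h <;> simp [h]
  obtain ⟨eb, heb, hebε⟩ := Walk.exists_signFunction (-W.rootNumber) hε
  have h53D : ∀ (s s' : {m : ℕ // Squarefree m ∧ ∀ q ∈ m.primeFactors,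
        Zhang2014.IsKolyvaginPrime (W.conductorNorm ℤ) W K 3 q ∧ k ≤ Zhang2014.kolyvaginIndex W 3 q})
      (_ : s'.1 ∣ s.1) (τm : ringClassField K ι s'.1 ≃ₐ[ℚ] ringClassField K ι s'.1),
      (∀ x : ringClassField K ι s'.1, ((τm x : ringClassField K ι s'.1) : ℂ) = starRingEnd ℂ x) →
      ∃ σ' ∈ ringClassGal ι s'.1, IsOfFinAddOrder
        (pointGalHom W (ringClassField K ι s'.1) τm (D s').y -
          (-W.rootNumber) • pointGalHom W (ringClassField K ι s'.1) σ' (D s').y) := by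
    intro s s' _ τm hτm
    obtain ⟨hm0, hmN⟩ := ne_zero_and_coprime_of_isKolyvaginPrime (K := K) s'.2.1
      (fun q hq ↦ (s'.2.2 q hq).1)
    exact exists_mem_ringClassGal_isOfFinAddOrder_conj_sub_smul W hK' hHN Dt ι hm0 hmN (D s') τm hτm
  -- the supply at this frame, for these data and signs
  obtain ⟨𝒯, 𝒮, Qcar, C', hS, hQcar, hdisj, hPT, hselmer, hC, hdual_q, hsel0, hdual_ℓ⟩ :=
    hsupply W K Dt β ι hX hns hK' hHN hodd hβ hc τ hτ v k hk h2 n d hn D hDd (-W.rootNumber) hε eb heb hebε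
  have h49 := h49_of_selmerMembership_of_irreducible W hK' hND hD hp2 hirr hHp Dt β ι hτ hk 𝒯 𝒮 Qcar D eb
    (-W.rootNumber) hebε h53D n hsel0
  have hordκ := hordκ_of_admissibleData_of_irreducible W hK' hND hD hp2 hirr hHp Dt β ι k D
  -- finiteness of `ord_3 P_s` at `M(s) = ∞` is needed only at the base conductor, where it is `h1`
  have hdivfin : ∀ s : {m : ℕ // Squarefree m ∧ ∀ q ∈ m.primeFactors,
      Zhang2014.IsKolyvaginPrime (W.conductorNorm ℤ) W K 3 q ∧ k ≤ Zhang2014.kolyvaginIndex W 3 q},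
      n ∣ s.1 → Zhang2014.levelIndex W 3 s.1 = ⊤ → divOrd (D s) 3 ≠ ⊤ := by
    intro s hns hM
    have hs1 : s.1 = 1 := by
      by_contra h
      have hne : s.1.primeFactors.Nonempty := Nat.nonempty_primeFactors.mpr (by
        have := s.2.1.ne_zero; omega)
      obtain ⟨r, hr⟩ := hne
      have hle := (Zhang2014.natCast_le_levelIndex_iff (W := W) (p := 3)
        (M := Zhang2014.kolyvaginIndex W 3 r + 1) (n := s.1)).mp (by rw [hM]; exact le_top) r hr
      omega
    have hn1 : n = 1 := Nat.eq_one_of_dvd_one (hs1 ▸ hns)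
    subst hn1
    have hsd : s = ⟨1, hn⟩ := Subtype.ext hs1
    subst hsd
    rw [hDd]
    intro htop
    rw [htop] at h1
    simp at h1
  have hfin := JET.Walk.hfin_of_kummer (K := K) W hp k 𝒯
  have hκt := hκt_of_selmerMembership_of_irreducible W hK' hND hD hp2 hirr hHp Dt β ι hτ hk 𝒯 D eb
    (-W.rootNumber) hebε h53D n hdivfin hselmer
  have key := tamagawaExponent_le_m_of_orderedFamiliesBase_of_chebotarev W K 3 Dt β ι τ k
    (padicValNat 3 (W.tamagawaNumberAt v)) h2
    (fun j e he x y hx hy hy0 b ↦ exists_kolyvaginPrime_addOrderOf_localization_eq_shift_of_irr_of_neg W hK'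
      hp2 hirr hneg hq hqd hqN hqp τ hτ hk j he x y hx hy hy0 b)
    𝒯 𝒮 hS Qcar hQcar D eb heb n hn ?_ ?_ hdisj hfin hPT hκt hordκ h47 C' hC hdual_q h49 hdual_ℓ
  · rw [hDd] at key
    exact key
  · rw [hDd]; exact h1
  · rw [hDd]; exact h3


/-! ### §3 The divisibility per frame, and §4 the print-keyed displays on `d_K ≡ 1 (mod 8)` frames -/
/-- **`P_n ∈ 3^s E(K[n])` (the body of 19111's `stub_upper3_jetchevMaxMono` ∕ lane A's `stub_upper3_jetchevMax`) AT ONE FRAME,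
from Poitou–Tate, [GZ86 III (3.1)] image-free, and the (γ)-pair congruence AT THAT FRAME** — the per-frame form of this seat's
display `cornerUpper3_jetchevMax_of_namedFacts` (g11, p566368): `pDiv_of_swap_of_perLevel` at depth `t := ord₃ c_v(E/ℚ)` with
hswap := `Swap.levelRaising_of_pair_of_irreducible … h372WK …` (Kolyvagin's prime swap = McCallum Prop. 5.2's content) and
hlev := `hlevThreeAt_of_pairAt_of_selmerSupply` over `selmerSupplyCornerThree_of_poitouTate_Gross1991 hPT hF1`.
The point of the per-frame form: the (γ)-pair congruence is needed ONLY at the frame `(W, K)` at which the divisibility is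
read — so on frames where it follows from print (§1: `d_K ≡ 1 (mod 8)`), the display is keyed on print alone (§4).
CONDITIONAL on `hPT`, `hF1`, `h372WK`; the registered stub is NOT discharged; nothing booked; T7.
[cite: Jetchev2008, Thm. 1.4 (p. 812)] [cite: McCallumLMS1991, §4 Prop. 4.4, §5 Prop. 5.2] [cite: GrossZagier1986, III (3.1)]
[cite: MilneADT2006, Ch. I, Thm. 4.10(b)] -/
theorem pDivThree_of_pairAt_of_namedFacts
    (hPT : ∀ (K : Type) [Field K] [NumberField K], poitouTate_selmerStructure_duality_conj K)
    (hF1 : Gross1991_heegnerPoint_sub_ratTorsion_mem_E0_imageFree)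
    (W : WeierstrassCurve ℚ) [W.IsElliptic] [W.IsGloballyMinimal] [NeZero (W.conductorNorm ℤ)]
    (K : Type) [Field K] [NumberField K]
    (Dt : ModularParametrizationData W (W.conductorNorm ℤ)) (β : ℤ) (ι : K →+* ℂ)
    (hX : ClassX11b W 3) (hns : ¬ Surj W 3)
    (hK' : IsImaginaryQuadratic K) (hHN : SatisfiesHeegnerHypothesis (W.conductorNorm ℤ) K)
    (hodd : Odd (NumberField.discr K))
    (hβ : (4 * (W.conductorNorm ℤ : ℤ)) ∣ β ^ 2 - NumberField.discr K) (hc : ¬ (3 : ℤ) ∣ Dt.c)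
    (h372WK : Prop44.prop37_2_reductionCongruence_pair W K) :
    ∀ (v : HeightOneSpectrum (𝓞 ℚ)) (s : ℕ), s ≤ padicValNat 3 (W.tamagawaNumberAt v) →
      ∀ (n : ℕ) (d : KolyvaginHeegnerData Dt β ι n), Squarefree n →
        (∀ ℓ ∈ n.primeFactors, Zhang2014.IsKolyvaginPrime (W.conductorNorm ℤ) W K 3 ℓ ∧
          s ≤ Zhang2014.kolyvaginIndex W 3 ℓ) → PDiv d 3 s := by
  haveI : Fact (Nat.Prime 3) := ⟨Nat.prime_three⟩
  intro v s hs n₁ d₁ hn₁ hℓ₁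
  refine pDiv_of_swap_of_perLevel 3 (padicValNat 3 (W.tamagawaNumberAt v)) ?_
    (hlevThreeAt_of_pairAt_of_selmerSupply (selmerSupplyCornerThree_of_poitouTate_Gross1991 hPT hF1)
      W K Dt β ι hX hns hK' hHN hodd hβ hc h372WK v) s hs n₁ d₁ hn₁ hℓ₁
  intro M e n d hsq hnK hall hnd
  have hp2 : (3 : ℕ) ≠ 2 := by decide
  have hirr : W.HasIrreducibleModPGaloisRep 3 := hX.2.2.2
  have h3N : 3 ∣ W.conductorNorm ℤ := dvd_conductorNorm_of_mult hX.2.2.1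
  have hHp : SatisfiesHeegnerHypothesis 3 K := hHN.of_dvd h3N
  have h3d : ¬ (3 : ℤ) ∣ NumberField.discr K := by
    exact_mod_cast Literature.SatisfiesHeegnerHypothesis.not_dvd_discr hK'.1 hHN Nat.prime_three h3N
  have hd : 4 < (NumberField.discr K).natAbs := four_lt_natAbs_discr_of_odd hK'.1 hodd h3d
  have hDneg : NumberField.discr K < 0 := (isImaginaryQuadratic_iff_discr_neg.1 hK').2
  have hD3 : NumberField.discr K ≠ -3 := by omega
  have hD4 : NumberField.discr K ≠ -4 := by omega
  obtain ⟨q₀, hq₀, hq₀d, hq₀N, hq₀p⟩ := exists_prime_dvd_discr_of_heegner hK'.1 hd hHN hHp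
  have hneg : ∃ γ : Field.absoluteGaloisGroup ℚ, ∀ P : geomTorsion W 3, γ • P = -P := by
    obtain ⟨γ, hγ⟩ := ShimuraKolyvaginMinusOneSquare.exists_sq_smul_eq_neg_three_of_irr W hirr
    exact ⟨γ * γ, fun P ↦ by rw [mul_smul]; exact hγ P⟩
  haveI : ∀ j : ℕ, NumberField (ringClassField K ι j) := numberField_ringClassField K hK' ι
  have hidx : ∀ {c : ℕ}, (∀ q ∈ c.primeFactors, Zhang2014.IsKolyvaginPrime (W.conductorNorm ℤ) W K 3 q ∧
      1 + M ≤ Zhang2014.kolyvaginIndex W 3 q) → ∀ q ∈ c.primeFactors,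
      Zhang2014.IsKolyvaginPrime (W.conductorNorm ℤ) W K 3 q ∧ M + 1 ≤ Zhang2014.kolyvaginIndex W 3 q :=
    fun h q hq ↦ ⟨(h q hq).1, by rw [Nat.add_comm]; exact (h q hq).2⟩
  obtain ⟨n', d', hn', hn'K, hnd'⟩ := Swap.levelRaising_of_pair_of_irreducible hPT hF1 W K hK' hD3 hD4 hHN h372WK 3 hp2
    hirr hHp hneg hq₀ hq₀d hq₀N hq₀p Dt β ι M (fun c hc hcK dc ↦ hall c dc hc (hidx hcK)) n hsq
    (fun q hq ↦ ⟨(hnK q hq).1, by rw [Nat.add_comm]; exact (hnK q hq).2⟩) d hnd e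
  exact ⟨n', d', hn', fun q hq ↦ ⟨(hn'K q hq).1, le_trans (le_max_left _ _) (hn'K q hq).2⟩, hnd'⟩


/-- **DISPLAY (print-keyed) — on the (T4″)@3 corner frames with `d_K ≡ 1 (mod 8)`, `P_n ∈ 3^s E(K[n])` for all
`s ≤ ord₃ c_v(E/ℚ)` at Kolyvagin levels of index `≥ s` ⟸ EXACTLY THREE NAMED LITERATURE FACTS {Gross 1991 Prop. 3.7 (2) =
`GrossLMS1991.prop37_2_frobeniusCongruence` (A′), Poitou–Tate, [GZ86 III (3.1)] image-free}** — no (γ)-twin def, no `h2`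
residue, no supply hypothesis, `−1 ∈ ρ̄_{E,3}(Γ_ℚ)` automatic. The body is that of 19111's `stub_upper3_jetchevMaxMono` (line
`Cruxes/CornerAtThree/Lines/inert.lean`) with the single extra frame binder `NumberField.discr K % 8 = 1` (and without the
mono-carrier restriction, which only weakens it). The frames the CONSUMER of conjunct 3 actually books are of this kind: the
Heegner field of `X11b.exists_oddHeegnerData` comes from Hoffstein–Luo's theorem with `2` adjoined to `S`, i.e. with
`d ≡ 1 (mod 8)` (`HoffsteinLuo1997_exists_twist_L_one_ne_zero`: "`d % 8 = 1`") — see the companion file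
`…UpperModEightConsumed` for the consumed shape `Typed.MissingUpperBoundAt W 3` on mono-carrier corner curves keyed on print.
HONEST FRAMING: CONDITIONAL on three published, typed, unformalised facts; the registered stub (all odd `d_K`) is NOT
discharged — at `d_K ≡ 5 (mod 8)` frames the Kolyvagin prime `ℓ = 2` is live on 37 ∕ 296 corner pairs (mult-p3 g5 census) and
the (γ)-twin ∕ `h2` remains the displayed input there (p566368); no item closes; nothing about any curve's BSD; T7.
[cite: GrossLMS1991, Prop. 3.7 (2) (p. 240)] [cite: Nekovar2007, Prop. 4.13 (ii)] [cite: HoffsteinLuo1997, Theorem (§1)]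
[cite: Jetchev2008, Thm. 1.4 (p. 812)] [cite: McCallumLMS1991, §4 Prop. 4.4, §5 Prop. 5.2] [cite: GrossZagier1986, III (3.1)] -/
theorem pDivThree_of_threeNamedFacts_of_discr_mod_eight
    -- NAMED LITERATURE FACTS (cite-only)
    (h37 : GrossLMS1991.prop37_2_frobeniusCongruence)
    (hPT : ∀ (K : Type) [Field K] [NumberField K], poitouTate_selmerStructure_duality_conj K)
    (hF1 : Gross1991_heegnerPoint_sub_ratTorsion_mem_E0_imageFree) :
    ∀ (W : WeierstrassCurve ℚ) [W.IsElliptic] [W.IsGloballyMinimal] [NeZero (W.conductorNorm ℤ)]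
      (K : Type) [Field K] [NumberField K]
      (Dt : ModularParametrizationData W (W.conductorNorm ℤ)) (β : ℤ) (ι : K →+* ℂ),
      ClassX11b W 3 → ¬ Surj W 3 →
      IsImaginaryQuadratic K → SatisfiesHeegnerHypothesis (W.conductorNorm ℤ) K →
      Odd (NumberField.discr K) → NumberField.discr K % 8 = 1 →
      (4 * (W.conductorNorm ℤ : ℤ)) ∣ β ^ 2 - NumberField.discr K → ¬ (3 : ℤ) ∣ Dt.c →
      ∀ (v : HeightOneSpectrum (𝓞 ℚ)) (s : ℕ), s ≤ padicValNat 3 (W.tamagawaNumberAt v) →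
        ∀ (n : ℕ) (d : KolyvaginHeegnerData Dt β ι n), Squarefree n →
          (∀ ℓ ∈ n.primeFactors, Zhang2014.IsKolyvaginPrime (W.conductorNorm ℤ) W K 3 ℓ ∧
            s ≤ Zhang2014.kolyvaginIndex W 3 ℓ) → PDiv d 3 s :=
  fun W _ _ _ K _ _ Dt β ι hX hns hK' hHN hodd hd8 hβ hc ↦
    pDivThree_of_pairAt_of_namedFacts hPT hF1 W K Dt β ι hX hns hK' hHN hodd hβ hc
      (Prop44.prop37_2_reductionCongruence_pair_of_frobeniusCongruence_of_discr_mod_eight_eq_one h37 W K hd8)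

/-- **The same display in the exact binder order of 19111's `stub_upper3_jetchevMaxMono` (line `Lines/inert.lean`), with the one
extra frame binder `NumberField.discr K % 8 = 1` placed after `Odd (NumberField.discr K)`** — the planner's re-keying option for the
stub (mono-carrier restriction kept, unused). CONDITIONAL on the three named facts; nothing booked; T7.
[cite: GrossLMS1991, Prop. 3.7 (2)] [cite: Jetchev2008, Thm. 1.4 (p. 812)] -/
theorem cornerUpper3_jetchevMaxMono_of_threeNamedFacts_of_discr_mod_eight
    (h37 : GrossLMS1991.prop37_2_frobeniusCongruence)
    (hPT : ∀ (K : Type) [Field K] [NumberField K], poitouTate_selmerStructure_duality_conj K)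
    (hF1 : Gross1991_heegnerPoint_sub_ratTorsion_mem_E0_imageFree) :
    ∀ (W : WeierstrassCurve ℚ) [W.IsElliptic] [W.IsGloballyMinimal] [NeZero (W.conductorNorm ℤ)]
      (K : Type) [Field K] [NumberField K]
      (Dt : ModularParametrizationData W (W.conductorNorm ℤ)) (β : ℤ) (ι : K →+* ℂ),
      3 ∣ W.tamagawaProduct →
      (∃ v : HeightOneSpectrum (𝓞 ℚ),
        padicValNat 3 W.tamagawaProduct ≤ padicValNat 3 (W.tamagawaNumberAt v)) →
      ClassX11b W 3 → ¬ Surj W 3 →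
      IsImaginaryQuadratic K → SatisfiesHeegnerHypothesis (W.conductorNorm ℤ) K →
      Odd (NumberField.discr K) → NumberField.discr K % 8 = 1 →
      (4 * (W.conductorNorm ℤ : ℤ)) ∣ β ^ 2 - NumberField.discr K → ¬ (3 : ℤ) ∣ Dt.c →
      ∀ (v : HeightOneSpectrum (𝓞 ℚ)) (s : ℕ), s ≤ padicValNat 3 (W.tamagawaNumberAt v) →
        ∀ (n : ℕ) (d : KolyvaginHeegnerData Dt β ι n), Squarefree n →
          (∀ ℓ ∈ n.primeFactors, Zhang2014.IsKolyvaginPrime (W.conductorNorm ℤ) W K 3 ℓ ∧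
            s ≤ Zhang2014.kolyvaginIndex W 3 ℓ) → PDiv d 3 s :=
  fun W _ _ _ K _ _ Dt β ι _ _ hX hns hK' hHN hodd hd8 hβ hc ↦
    pDivThree_of_threeNamedFacts_of_discr_mod_eight h37 hPT hF1 W K Dt β ι hX hns hK' hHN hodd hd8 hβ hc

end Summit.BirchSwinnertonDyer.Rank1Residual.X11b.Three.Koly

end
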